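import Literature.AnabelianGeometry.SemiGraphs.ThetaRayExoticMaximalCompact
import Literature.AnabelianGeometry.SemiGraphs.ThetaRayLevelKernel
import Literature.AnabelianGeometry.SemiGraphs.FreeProPRankTwoTwistCores
import HarnessLib

/-!
# Escape of the POWERS of the escaping element of `π₁^temp(𝒢_θ)` (typed-form audit of [SemiAnbd] Thm 3.7 (iv)
# clause 2 at `𝒢_θ`, row «B9·ANCHOR-FREE-PAIR», brick K-B3)

Mochizuki, *Semi-graphs of anabelioids*, Publ. RIMS **42** (2006), §3, Theorem 3.7 (iii)/(iv) pp. 40–41, proof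
p. 41 (the sub-joint argument) [cite: MochizukiSemiAnbd2006, Thm 3.7(iii) p.41].

PROOF-ONLY file (abc-iut cell, layer L3, seat abc-iut-L3-d4 gen 5; row «B9·ANCHOR-FREE-PAIR@𝒢_θ» (L3-lead
β50/γ10); frontier / erratum-grade label — typed-form audit of the cell's ∀-countable typing of Thm 3.7 (iv)
at abc-iut-L3-d1's countermodel `𝒢_θ(p,n)`, OUTSIDE the [IUTchIII] Cor. 3.12 cone; 0 definitions, no named
fact).  Desk memo `HOME/staging/L3/L3-d4/g5/B9-ANCHOR-FREE-PAIR.md`, step (S3) for the element `c^{p^m}`.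

For the two-level argument «deep fixed points of `c^{p^m}` project onto fixed points of `c`» one needs that
the fixed points of `c^{p^m}` ESCAPE (at deep levels every `c^{p^m}`-fixed tree vertex is high), exactly as
abc-iut-L3-d4 gen 3's R6 level data (p437307/p437320/p441714) give it for `c` itself.  Here the R6 pipeline is
re-run for the `N₀`-th POWER: the apartment generators of `e₀^{N₀}` are `z_k^{N₀}`, so any `c` with
`ρ_j(c) = ρ_j(z_k)` (`k ≫_j 0`) has `ρ_j(c^{N₀}) = ρ_j(z'_k)`, and abc-iut-L3-t11's `thetaRay_levelEscape_data`
(hfar) and gen 3's `thetaRay_hcrit_of_characters` (hcrit, NEGATIVE-MODULO binders χ/ab/hK/hsep now for the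
generator `e₀^{N₀}`) feed gen 3's `height_unbounded_of_criticalFree`:

* `thetaRay_heightEscape_pow_of_characters` — generic ray of groups, binder form;
* `FreeProPRankTwo.abMod_θ_α_ne_abMod_α_of_add_lt` — the (c5) separation for the generator `p^m` at a level
  `e > n + m` (the model arithmetic the concrete `hsep` needs);
* `thetaRayFreeProP_heightEscape_pow` — at `𝒢_θ(p,n)`, every schedule `n_k → ∞`: for every `c` of the
  canonical `π₁^temp` with `ρ_j(c) = ρ_j(z_k)` for `k ≫_j 0` and every `m`, the fixed tree vertices of `c^{p^m}`
  escape.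

Nothing of [SemiAnbd] is asserted or refuted; nothing bears on [IUTchIII] Cor. 3.12; typed ≠ proved.
-/

noncomputable section

namespace Literature.AnabelianGeometry.SemiGraphs

open CategoryTheory Filter Topology Multiplicative
open ProfiniteSemiGraph ProfiniteSemiGraph.GaloisLevelData

/-! ### Generic ray of groups: escape of the powers, binder form -/

section Generic

variable {G E : Type} [Group G] [TopologicalSpace G] [IsTopologicalGroup G] [CompactSpace G]
  [TotallyDisconnectedSpace G] [Group E] [TopologicalSpace E] [IsTopologicalGroup E] [CompactSpace E]
  [TotallyDisconnectedSpace E] {up : E →ₜ* G} {low : ℕ → (E →ₜ* G)}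
  {A V : ℕ → Type} [∀ n, CommGroup (A n)] [∀ n, TopologicalSpace (A n)] [∀ n, DiscreteTopology (A n)]
  [∀ n, Finite (A n)] [∀ n, CommGroup (V n)]

/-- **Escape of the `N₀`-th power of the escaping element** (generic ray of groups, NEGATIVE-MODULO binders for
the generator `e₀ ^ N₀` as in abc-iut-L3-d4's `thetaRay_hcrit_of_characters`): if `ρ_j(c) = ρ_j(z_k)` for
`k ≫_j 0` (`z_k` the apartment generators of `e₀`), then for every bound `B` there is a level at which every
`c^{N₀}`-fixed vertex of the tree lies over a vertex of height `≥ B`. [cite: MochizukiSemiAnbd2006, Thm 3.7(iii) p.41] -/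
theorem thetaRay_heightEscape_pow_of_characters
    (h37 : (thetaRay G E up low).Thm37Hypotheses)
    (P₀ : ((thetaRay G E up low).galoisLevelData h37.toProp36Hypotheses).PointSeq h37.isCountable (0 : ℕ))
    (e₀ : E) (N₀ : ℕ)
    (hcoin : ∀ d : ℕ, ∃ N : ℕ, ∀ k, N ≤ k → (low (k + 1) (e₀ ^ N₀))⁻¹ * up (e₀ ^ N₀) ∈ charOpenCore G d)
    (χG : ∀ n, G →ₜ* A n) (hχA : ∀ (n k : ℕ) (t : E), χG n (low k t) = χG n (up t))
    (ab : ∀ n, G →* V n)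
    (hK : ∀ n : ℕ, ∃ j₀ : ℕ, ∀ j, j₀ ≤ j → ∀ (w : ℕ)
      (P : ((thetaRay G E up low).galoisLevelData h37.toProp36Hypotheses).PointSeq h37.isCountable w)
      (x : G), P.gal j x = 1 → ab n x = 1)
    (hsep : ∀ (n : ℕ) (t₁ t₂ : E), χG n (low (n + 1) t₁) = χG n (up (e₀ ^ N₀)) →
      χG n (up t₂) = χG n (up (e₀ ^ N₀)) → ab n (low (n + 1) t₁) ≠ ab n (up t₂))
    (c : ((thetaRay G E up low).galoisLevelData h37.toProp36Hypotheses).temperedPi h37.isCountable)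
    (hc : ∀ j : ℕ, ∃ N : ℕ, ∀ k, N ≤ k →
      ((thetaRay G E up low).galoisLevelData h37.toProp36Hypotheses).projAut h37.isCountable j c =
        ((thetaRay G E up low).galoisLevelData h37.toProp36Hypotheses).projAut h37.isCountable j
          ((rayPointSeq (D := (thetaRay G E up low).galoisLevelData h37.toProp36Hypotheses) thetaRay_ham
            thetaRay_hap thetaRay_hmp P₀ (k + 1)).decompHom
            ((thetaRay G E up low).brHom (k, true) (k + 1) (thetaRay_hap k) e₀))) :
    ∀ B : ℕ, ∃ j : ℕ,
      ∀ y : ((verticialLevelData_temperedPiChart (h36 := h37.toProp36Hypotheses)).tree j).Vertex,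
        ((verticialLevelData_temperedPiChart (h36 := h37.toProp36Hypotheses)).act j (c ^ N₀)).hom.vertexMap y
            = y →
          B ≤ ((verticialLevelData_temperedPiChart (h36 := h37.toProp36Hypotheses)).proj j).vertexMap y := by
  classical
  have hcnt := h37.isCountable
  let Dg : GaloisLevelData (thetaRay G E up low) := (thetaRay G E up low).galoisLevelData h37.toProp36Hypotheses
  let Vd := verticialLevelData_temperedPiChart (h36 := h37.toProp36Hypotheses)
  -- the apartment generators of the power `e₀ ^ N₀` and their level data
  obtain ⟨-, -, hfar⟩ := thetaRay_levelEscape_data h37.toProp36Hypotheses P₀ (e₀ ^ N₀) hcoin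
  have hcrit := thetaRay_hcrit_of_characters h37.toProp36Hypotheses P₀ (e₀ ^ N₀) χG hχA ab hK hsep
  -- `z'_k = z_k ^ N₀`
  have hz' : ∀ k : ℕ,
      (rayPointSeq (D := Dg) thetaRay_ham thetaRay_hap thetaRay_hmp P₀ (k + 1)).decompHom
          ((thetaRay G E up low).brHom (k, true) (k + 1) (thetaRay_hap k) (e₀ ^ N₀)) =
        ((rayPointSeq (D := Dg) thetaRay_ham thetaRay_hap thetaRay_hmp P₀ (k + 1)).decompHom
          ((thetaRay G E up low).brHom (k, true) (k + 1) (thetaRay_hap k) e₀)) ^ N₀ := fun k =>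
    map_pow ((rayPointSeq (D := Dg) thetaRay_ham thetaRay_hap thetaRay_hmp P₀ (k + 1)).decompHom.comp
      ((thetaRay G E up low).brHom (k, true) (k + 1) (thetaRay_hap k)).toMonoidHom) e₀ N₀
  -- `ρ_j(c ^ N₀) = ρ_j(z'_k)` for `k ≫_j 0`
  choose N hN using hc
  have hact0 : ∀ j k, N j ≤ k → Dg.treeAct hcnt j c = Dg.treeAct hcnt j
      ((rayPointSeq (D := Dg) thetaRay_ham thetaRay_hap thetaRay_hmp P₀ (k + 1)).decompHom
        ((thetaRay G E up low).brHom (k, true) (k + 1) (thetaRay_hap k) e₀)) := fun j k hk => by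
    rw [Dg.treeAct_apply hcnt, Dg.treeAct_apply hcnt]
    exact congrArg _ (hN j k hk)
  have hact : ∀ j k, N j ≤ k → Dg.treeAct hcnt j (c ^ N₀) = Dg.treeAct hcnt j
      ((rayPointSeq (D := Dg) thetaRay_ham thetaRay_hap thetaRay_hmp P₀ (k + 1)).decompHom
        ((thetaRay G E up low).brHom (k, true) (k + 1) (thetaRay_hap k) (e₀ ^ N₀))) := fun j k hk => by
    rw [hz' k, map_pow, map_pow, hact0 j k hk]
  -- hfar / hcrit for `c ^ N₀`
  have hfar_c : ∀ (j : Vd.J) (n : ℕ), ∃ x : (Vd.tree j).Vertex,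
      n ≤ (fun v : ℕ => v) ((Vd.proj j).vertexMap x) ∧ (Vd.act j (c ^ N₀)).hom.vertexMap x = x := by
    intro j n
    obtain ⟨x, hx, hfix⟩ := hfar (max n (N j)) j
    refine ⟨x, le_trans (le_max_left _ _) hx, ?_⟩
    change (Dg.treeAct hcnt j (c ^ N₀)).hom.vertexMap x = x
    rw [hact j (max n (N j)) (le_max_right _ _)]
    exact hfix
  have hcrit_c : ∀ n : ℕ, ∃ j₀ : Vd.J, ∀ j, j₀ ≤ j →
      ∀ (v : (Vd.tree j).Vertex) (b b' : (Vd.tree j).Branch),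
        (Vd.tree j).abuts b = some v → (Vd.tree j).abuts b' = some v →
        (fun v : ℕ => v) ((Vd.proj j).vertexMap v) = n + 1 →
        (Vd.act j (c ^ N₀)).hom.edgeMap ((Vd.tree j).edgeOf b) = (Vd.tree j).edgeOf b →
        (Vd.act j (c ^ N₀)).hom.edgeMap ((Vd.tree j).edgeOf b') = (Vd.tree j).edgeOf b' →
        (∃ (b₂ : (Vd.tree j).Branch) (v₂ : (Vd.tree j).Vertex), b₂ ≠ b ∧
          (Vd.tree j).edgeOf b₂ = (Vd.tree j).edgeOf b ∧ (Vd.tree j).abuts b₂ = some v₂ ∧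
          (fun v : ℕ => v) ((Vd.proj j).vertexMap v₂) = n + 2) →
        (∃ (b₂ : (Vd.tree j).Branch) (v₂ : (Vd.tree j).Vertex), b₂ ≠ b' ∧
          (Vd.tree j).edgeOf b₂ = (Vd.tree j).edgeOf b' ∧ (Vd.tree j).abuts b₂ = some v₂ ∧
          (fun v : ℕ => v) ((Vd.proj j).vertexMap v₂) = n) → False := by
    intro n
    obtain ⟨j₀, hj₀⟩ := hcrit n
    refine ⟨j₀, fun j hj y b b' hb hb' hy he he' hup hdown => ?_⟩
    obtain ⟨N', hN'⟩ := hj₀ j hj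
    have hk : N' ≤ max N' (N j) := le_max_left _ _
    change (Dg.treeAct hcnt j (c ^ N₀)).hom.edgeMap _ = _ at he
    change (Dg.treeAct hcnt j (c ^ N₀)).hom.edgeMap _ = _ at he'
    rw [hact j (max N' (N j)) (le_max_right _ _)] at he he'
    exact hN' _ hk y b b' hb hb' hy he he' hup hdown
  exact Vd.height_unbounded_of_criticalFree (fun v : ℕ => v) SemiGraph.ray_heightStep (c ^ N₀) hfar_c hcrit_c

end Generic

/-! ### The model arithmetic for the generator `p^m` -/

namespace FreeProPRankTwo

variable (p : ℕ) [hp : Fact p.Prime]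

/-- **Separation of the two gluings for the generator `p^m` at a level `e > n + m`**: if `θₙ (α t₁)` and
`α t₂` have the same level-`pᵉ` character as `α (p^m) = a^{p^m}`, their level-`pᵉ` abelianisations differ —
`(p^m, p^{n+m}) ≠ (p^m, 0)` in `(ℤ/pᵉ)²`. [cite: RibesZalesskii2010, §3.3] -/
theorem abMod_θ_α_ne_abMod_α_of_add_lt {e n m : ℕ} (h : n + m < e) (t₁ t₂ : Multiplicative ℤ_[p])
    (h₁ : χaMod p e (θ p n (α p t₁)) = χaMod p e (α p (ofAdd ((p : ℤ_[p]) ^ m))))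
    (h₂ : χaMod p e (α p t₂) = χaMod p e (α p (ofAdd ((p : ℤ_[p]) ^ m)))) :
    abMod p e (θ p n (α p t₁)) ≠ abMod p e (α p t₂) := by
  rw [χaMod_θ_α, χaMod_α] at h₁
  rw [χaMod_α, χaMod_α] at h₂
  have ht₁ : PadicInt.toZModPow e t₁.toAdd = (p : ZMod (p ^ e)) ^ m := by
    have := Multiplicative.ofAdd.injective h₁
    rw [this, toAdd_ofAdd, map_pow, map_natCast]
  have ht₂ : PadicInt.toZModPow e t₂.toAdd = (p : ZMod (p ^ e)) ^ m := by
    have := Multiplicative.ofAdd.injective h₂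
    rw [this, toAdd_ofAdd, map_pow, map_natCast]
  rw [abMod_θ_α, abMod_α, ht₁, ht₂]
  intro hEq
  have h2 := congrArg (fun x : Multiplicative (ZMod (p ^ e) × ZMod (p ^ e)) => x.toAdd.2) hEq
  simp only [toAdd_ofAdd] at h2
  rw [← pow_add] at h2
  exact prime_pow_natCast_ne_zero p h h2

end FreeProPRankTwo

/-! ### The countermodel `𝒢_θ(p, n)`: escape of `c^{p^m}` -/

namespace ProfiniteSemiGraph

open Literature.AnabelianGeometry.SemiGraphs.FreeProPRankTwo

variable (p : ℕ) [hp : Fact p.Prime] (n : ℕ → ℕ)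

/-- **At `𝒢_θ(p,n)` (every schedule `n_k → ∞`) the fixed tree vertices of every power `c^{p^m}` of an
escaping element `c` (`ρ_j(c) = ρ_j(z_k)` for `k ≫_j 0`, `z_k = ψ_{k+1}(a)` the apartment generators) ESCAPE**:
for every bound `B` some level has all `c^{p^m}`-fixed vertices of height `≥ B`.
[cite: MochizukiSemiAnbd2006, Thm 3.7(iii) p.41] -/
theorem thetaRayFreeProP_heightEscape_pow (hn : Tendsto n atTop atTop)
    (h37 : (thetaRayFreeProP p n).Thm37Hypotheses)
    (P₀ : ((thetaRayFreeProP p n).galoisLevelData h37.toProp36Hypotheses).PointSeq h37.isCountable (0 : ℕ))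
    (c : ((thetaRayFreeProP p n).galoisLevelData h37.toProp36Hypotheses).temperedPi h37.isCountable)
    (hc : ∀ j : ℕ, ∃ N : ℕ, ∀ k, N ≤ k →
      ((thetaRayFreeProP p n).galoisLevelData h37.toProp36Hypotheses).projAut h37.isCountable j c =
        ((thetaRayFreeProP p n).galoisLevelData h37.toProp36Hypotheses).projAut h37.isCountable j
          ((rayPointSeq (D := (thetaRayFreeProP p n).galoisLevelData h37.toProp36Hypotheses) thetaRay_ham
            thetaRay_hap thetaRay_hmp P₀ (k + 1)).decompHom
            ((thetaRayFreeProP p n).brHom (k, true) (k + 1) (thetaRay_hap k) (ofAdd (1 : ℤ_[p])))))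
    (m : ℕ) :
    ∀ B : ℕ, ∃ j : ℕ,
      ∀ y : ((verticialLevelData_temperedPiChart (h36 := h37.toProp36Hypotheses)).tree j).Vertex,
        ((verticialLevelData_temperedPiChart (h36 := h37.toProp36Hypotheses)).act j (c ^ p ^ m)).hom.vertexMap y
            = y →
          B ≤ ((verticialLevelData_temperedPiChart (h36 := h37.toProp36Hypotheses)).proj j).vertexMap y := by
  classical
  haveI : NeZero p := ⟨hp.out.ne_zero⟩
  have h36 := h37.toProp36Hypotheses
  have hsc : (thetaRayFreeProP p n).IsStrictlyCoherent :=
    thetaRayFreeProP_isStrictlyCoherent p (α p) (α_ofAdd_one p) (fun m => θHom p m)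
      (fun m => (θ p m).bijective) n
  -- the generator `p^m` of `p^m ℤ_p` and its power relation to `1`
  have hd₀ : (ofAdd (1 : ℤ_[p])) ^ p ^ m = ofAdd ((p : ℤ_[p]) ^ m) := by
    rw [← ofAdd_nsmul, nsmul_eq_mul, mul_one, Nat.cast_pow]
  have hcoin : ∀ d : ℕ, ∃ N : ℕ, ∀ k, N ≤ k →
      ((fun k => θα p (n k)) (k + 1) ((ofAdd (1 : ℤ_[p])) ^ p ^ m))⁻¹ * α p ((ofAdd (1 : ℤ_[p])) ^ p ^ m) ∈
        charOpenCore (Grp p) d :=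
    FreeProPRankTwo.thetaRay_hcoin p hn _
  -- characters at the modulus `e(m') := n(m'+1) + 1 + m`
  have hχA : ∀ (m' k : ℕ) (t : Multiplicative ℤ_[p]),
      χaMod p (n (m' + 1) + 1 + m) ((fun k => θα p (n k)) k t) = χaMod p (n (m' + 1) + 1 + m) (α p t) := by
    intro m' k t
    change χaMod p _ (θ p (n k) (α p t)) = χaMod p _ (α p t)
    rw [χaMod_θ]
  have hK : ∀ m' : ℕ, ∃ j₀ : ℕ, ∀ j, j₀ ≤ j → ∀ (w : ℕ)
      (P : ((thetaRayFreeProP p n).galoisLevelData h36).PointSeq h37.isCountable w) (x : Grp p),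
      P.gal j x = 1 → (abMod p (n (m' + 1) + 1 + m)).toMonoidHom x = 1 :=
    thetaRayFreeProP_hK p (α p) (α_ofAdd_one p) (fun m => θHom p m) (fun m => (θ p m).bijective) n h36
      (fun m' => n (m' + 1) + 1 + m)
  have hsep : ∀ (m' : ℕ) (t₁ t₂ : Multiplicative ℤ_[p]),
      χaMod p (n (m' + 1) + 1 + m) ((fun k => θα p (n k)) (m' + 1) t₁) =
        χaMod p (n (m' + 1) + 1 + m) (α p ((ofAdd (1 : ℤ_[p])) ^ p ^ m)) →
      χaMod p (n (m' + 1) + 1 + m) (α p t₂) = χaMod p (n (m' + 1) + 1 + m) (α p ((ofAdd (1 : ℤ_[p])) ^ p ^ m)) →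
      (abMod p (n (m' + 1) + 1 + m)).toMonoidHom ((fun k => θα p (n k)) (m' + 1) t₁) ≠
        (abMod p (n (m' + 1) + 1 + m)).toMonoidHom (α p t₂) := by
    intro m' t₁ t₂ h₁ h₂
    rw [hd₀] at h₁ h₂
    exact abMod_θ_α_ne_abMod_α_of_add_lt p (by omega) t₁ t₂ h₁ h₂
  exact thetaRay_heightEscape_pow_of_characters (G := Grp p) (E := Multiplicative ℤ_[p]) (up := α p)
    (low := fun k => θα p (n k)) (A := fun m' => Multiplicative (ZMod (p ^ (n (m' + 1) + 1 + m))))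
    (V := fun m' => Multiplicative (ZMod (p ^ (n (m' + 1) + 1 + m)) × ZMod (p ^ (n (m' + 1) + 1 + m))))
    h37 P₀ (ofAdd 1) (p ^ m) hcoin (fun m' => χaMod p (n (m' + 1) + 1 + m)) hχA
    (fun m' => (abMod p (n (m' + 1) + 1 + m)).toMonoidHom) hK hsep c hc

end ProfiniteSemiGraph

end Literature.AnabelianGeometry.SemiGraphs

end
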